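/-
# Solo-blind programme on Kontsevich–Zagier, s17 (II): block rigidity — the induction step
# "weight `n` ⇒ weight `n+1`" of the `λ = 1/2` polylogarithm ladder (hodge.md 8.8)

Companion of `SoloBlindPolylogLadder`.  At `λ = 1/2` the Kummer classes of `λ` and `1 − λ` coincide,
the bracket trick is void, and the corner `E₀,ₙ₊₁` is reached instead by FUNCTORIALITY of the graded
unipotent Mumford–Tate Lie algebra `𝔲⁰ ⊂ 𝔫_{n+2}` under the sub-structure `W_{2n} P` (upper-left
block `ul`, which is the weight-`n` structure: induction hypothesis `N₁, E₀₃ ∈` its algebra) and the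
quotient `P / W₀ P` (lower-right block `lr`, which is `Symⁿ(Kummer) ⊗ ℚ(−1)`: its algebra is
`⊂ ℚ · N₁`).  The two constraints pin the lifts down completely:

* `drop1_eq_N1_of_blocks`: a superdiagonal matrix with `ul = N₁` and `lr ∈ K · N₁` IS `N₁` (rank ≥ 4);
* `drop3_eq_E03_of_blocks`: a drop-3 matrix with `ul = E₀₃` and `lr ∈ K · N₁` IS `E₀₃` (rank ≥ 5);

and then corner propagation (`corners_mem_of_N1_E03`) gives every `E₀ₖ`, `3 ≤ k ≤ n+1`
(`step_corners_mem`).  The base case (weight 3, `ζ(3) ≠ 0`) is `SoloBlindPolylogLie`; the Hodge-theoretic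
identification of the blocks is paper-level (hodge.md 8.8 (ii)–(iv)) and is NOT formalised here.

Section `towers` (hodge.md 8.9, several base points at once): in the graded conjugate the degree-one
elements are EXACT, `a₀ E₀₁ + a₁ N′` on each summand (Kummer theory), and the iterated bracket of two
of them is exactly `(a₀ b₁ − a₁ b₀) b₁^{n−1} E₀,ₙ₊₁` (`iterBr_tower`, `iterBr_tower_corner`): the
leading coefficient is the Bloch–Suslin symbol `(1 − λ) ∧ λ` evaluated on `φ_A ∧ φ_B`; it vanishes
identically on a summand where the two elements agree (`iterBr_self_succ`, the `λ = 1/2` tower).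
-/
import Summits.KontsevichZagierPeriods.KontsevichZagierPeriods.Theorems.SoloBlindPolylogLadder
import HarnessLib

namespace Summit.KontsevichZagierPeriods.KontsevichZagierPeriods.Theorems

namespace SoloBlind

namespace PolylogBlocks

open Matrix PolylogLadder

variable {K : Type*} [CommRing K] {n : ℕ}

local notation "𝕄" => Matrix (Fin (n + 2)) (Fin (n + 2)) K

/-! ## The two blocks

`ul M` is the upper-left `(n+1) × (n+1)` block (action on the sub-structure `W_{2n} P`), `lr M` the
lower-right block (action on the quotient `P / W₀ P`).  -/

/-- Upper-left block. -/
def ul (M : 𝕄) : Matrix (Fin (n + 1)) (Fin (n + 1)) K := M.submatrix Fin.castSucc Fin.castSucc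

/-- Lower-right block. -/
def lr (M : 𝕄) : Matrix (Fin (n + 1)) (Fin (n + 1)) K := M.submatrix Fin.succ Fin.succ

omit [CommRing K] in
/-- Entries of the upper-left block. -/
theorem ul_apply (M : 𝕄) (i j : Fin (n + 1)) : ul M i j = M i.castSucc j.castSucc := rfl

omit [CommRing K] in
/-- Entries of the lower-right block. -/
theorem lr_apply (M : 𝕄) (i j : Fin (n + 1)) : lr M i j = M i.succ j.succ := rfl

/-- BLOCK RIGIDITY, drop 1 (rank ≥ 4).  A superdiagonal matrix whose upper-left block is `N₁` and
whose lower-right block is a scalar multiple of `N₁` is `N₁` itself. -/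
theorem drop1_eq_N1_of_blocks (hn : 2 ≤ n) (u : 𝕄)
    (hu : ∀ i j : Fin (n + 2), (j : ℕ) ≠ i + 1 → u i j = 0)
    (hul : ul u = N1 K) (q : K) (hlr : lr u = q • N1 K) : u = N1 K := by
  have Hul : ∀ i j : Fin (n + 1), u i.castSucc j.castSucc = if (j : ℕ) = i + 1 then 1 else 0 := by
    intro i j
    have h := congrFun₂ hul i j
    rw [ul_apply, N1_apply] at h
    exact h
  have Hlr : ∀ i j : Fin (n + 1), u i.succ j.succ = if (j : ℕ) = i + 1 then q else 0 := by
    intro i j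
    have h := congrFun₂ hlr i j
    rw [lr_apply, Matrix.smul_apply, N1_apply, smul_eq_mul, mul_ite, mul_one, mul_zero] at h
    exact h
  -- the superdiagonal entry (1,2) lies in both blocks: it is 1 (upper-left) and q (lower-right)
  have h12a : u ⟨1, by omega⟩ ⟨2, by omega⟩ = 1 := by
    have h := Hul ⟨1, by omega⟩ ⟨2, by omega⟩
    rw [if_pos rfl] at h
    exact h
  have h12b : u ⟨1, by omega⟩ ⟨2, by omega⟩ = q := by
    have h := Hlr ⟨0, by omega⟩ ⟨1, by omega⟩
    rw [if_pos rfl] at h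
    exact h
  have hq : q = 1 := h12b.symm.trans h12a
  subst hq
  ext i j
  have hi2 := i.isLt
  have hj2 := j.isLt
  by_cases hij : (j : ℕ) = i + 1
  · rw [N1_apply, if_pos hij]
    rcases Nat.eq_zero_or_pos (i : ℕ) with hi | hi
    · have h := Hul ⟨i, by omega⟩ ⟨j, by omega⟩
      rw [if_pos (show (j : ℕ) = (i : ℕ) + 1 from hij)] at h
      exact h
    · have h := Hlr ⟨(i : ℕ) - 1, by omega⟩ ⟨(j : ℕ) - 1, by omega⟩
      rw [if_pos (show (j : ℕ) - 1 = (i : ℕ) - 1 + 1 by omega)] at h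
      have ei : Fin.succ (⟨(i : ℕ) - 1, by omega⟩ : Fin (n + 1)) = i :=
        Fin.ext (by simp only [Fin.val_succ]; omega)
      have ej : Fin.succ (⟨(j : ℕ) - 1, by omega⟩ : Fin (n + 1)) = j :=
        Fin.ext (by simp only [Fin.val_succ]; omega)
      rw [ei, ej] at h
      exact h
  · rw [hu i j hij, N1_apply, if_neg hij]

/-- BLOCK RIGIDITY, drop 3 (rank ≥ 5).  A drop-3 matrix whose upper-left block is `E₀₃` and whose
lower-right block is a scalar multiple of the drop-1 matrix `N₁` is `E₀₃` itself. -/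
theorem drop3_eq_E03_of_blocks (hn : 3 ≤ n) (u : 𝕄)
    (hu : ∀ i j : Fin (n + 2), (j : ℕ) ≠ i + 3 → u i j = 0)
    (hul : ul u = E K 0 (⟨3, by omega⟩ : Fin (n + 1))) (q : K) (hlr : lr u = q • N1 K) :
    u = E K 0 (⟨3, by omega⟩ : Fin (n + 2)) := by
  have Hul : ∀ i j : Fin (n + 1), u i.castSucc j.castSucc =
      if i = 0 ∧ j = (⟨3, by omega⟩ : Fin (n + 1)) then 1 else 0 := by
    intro i j
    have h := congrFun₂ hul i j
    rw [ul_apply, E_apply] at h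
    exact h
  have Hlr : ∀ i j : Fin (n + 1), u i.succ j.succ = if (j : ℕ) = i + 1 then q else 0 := by
    intro i j
    have h := congrFun₂ hlr i j
    rw [lr_apply, Matrix.smul_apply, N1_apply, smul_eq_mul, mul_ite, mul_one, mul_zero] at h
    exact h
  -- q = 0: the entry (1,2) is q (lower-right block) and 0 (drop 3)
  have hq : q = 0 := by
    have h := Hlr ⟨0, by omega⟩ ⟨1, by omega⟩
    rw [if_pos rfl] at h
    rw [← h]
    exact hu _ _ (by simp only [Fin.val_succ]; omega)
  subst hq
  ext i j
  have hi2 := i.isLt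
  have hj2 := j.isLt
  by_cases hi : (i : ℕ) = 0
  · by_cases hj : (j : ℕ) = 3
    · -- the corner entry itself, from the upper-left block
      have h := Hul ⟨i, by omega⟩ ⟨j, by omega⟩
      rw [if_pos ⟨Fin.ext (by rw [Fin.val_zero]; exact hi), Fin.ext hj⟩] at h
      rw [E_apply, if_pos ⟨Fin.ext (by rw [Fin.val_zero]; exact hi), Fin.ext hj⟩]
      exact h
    · rw [hu i j (by omega), E_apply, if_neg]
      rintro ⟨-, h⟩
      exact hj (congrArg Fin.val h)
  · by_cases hj0 : (j : ℕ) = 0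
    · rw [hu i j (by omega), E_apply, if_neg]
      rintro ⟨h, -⟩
      exact hi ((congrArg Fin.val h).trans (Fin.val_zero _))
    · have h := Hlr ⟨(i : ℕ) - 1, by omega⟩ ⟨(j : ℕ) - 1, by omega⟩
      simp only [ite_self] at h
      have ei : Fin.succ (⟨(i : ℕ) - 1, by omega⟩ : Fin (n + 1)) = i :=
        Fin.ext (by simp only [Fin.val_succ]; omega)
      have ej : Fin.succ (⟨(j : ℕ) - 1, by omega⟩ : Fin (n + 1)) = j :=
        Fin.ext (by simp only [Fin.val_succ]; omega)
      rw [ei, ej] at h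
      rw [h, E_apply, if_neg]
      rintro ⟨h0, -⟩
      exact hi ((congrArg Fin.val h0).trans (Fin.val_zero _))

/-- THE INDUCTION STEP OF hodge.md 8.8 in membership form.  Let `L` be a Lie-closed subspace of
`𝔤𝔩_{n+2}` (the graded conjugate of `𝔳⁽ⁿ⁺¹⁾`) containing a superdiagonal element `u₁` and a drop-3
element `u₃` whose upper-left blocks are `N₁` and `E₀₃` (the weight-`n` input) and whose lower-right
blocks are multiples of `N₁` (the quotient `P/W₀ = Sym Kummer` input).  Then `L` contains `N₁` and
every corner `E₀ₖ`, `3 ≤ k ≤ n + 1` — in particular the top corner `E₀,ₙ₊₁`. -/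
theorem step_corners_mem (hn : 3 ≤ n) (L : Submodule K 𝕄)
    (hL : ∀ X Y : 𝕄, X ∈ L → Y ∈ L → ⁅X, Y⁆ ∈ L)
    (u₁ u₃ : 𝕄) (h₁ : u₁ ∈ L) (h₃ : u₃ ∈ L)
    (hu₁ : ∀ i j : Fin (n + 2), (j : ℕ) ≠ i + 1 → u₁ i j = 0) (hul₁ : ul u₁ = N1 K)
    (q₁ : K) (hlr₁ : lr u₁ = q₁ • N1 K)
    (hu₃ : ∀ i j : Fin (n + 2), (j : ℕ) ≠ i + 3 → u₃ i j = 0)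
    (hul₃ : ul u₃ = E K 0 (⟨3, by omega⟩ : Fin (n + 1)))
    (q₃ : K) (hlr₃ : lr u₃ = q₃ • N1 K) (k : ℕ) (hk3 : 3 ≤ k) (hk : k < n + 2) :
    (N1 K : 𝕄) ∈ L ∧ (E K 0 (⟨k, hk⟩ : Fin (n + 2)) : 𝕄) ∈ L := by
  have hN : u₁ = N1 K := drop1_eq_N1_of_blocks (by omega) u₁ hu₁ hul₁ q₁ hlr₁
  have hE : u₃ = E K 0 (⟨3, by omega⟩ : Fin (n + 2)) :=
    drop3_eq_E03_of_blocks hn u₃ hu₃ hul₃ q₃ hlr₃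
  rw [hN] at h₁
  rw [hE] at h₃
  exact ⟨h₁, corners_mem_of_N1_E03 L hL h₁ (by omega) h₃ k hk3 hk⟩

/-! ## Two towers (hodge.md 8.9): brackets of EXACT degree-one elements

In the graded conjugate `𝔲⁰` of the Mumford–Tate Lie algebra of a direct sum of polylogarithm
structures, the degree-one part is known exactly (Kummer theory): its elements restrict to each
summand `P_λ` as `a₀ E₀₁ + a₁ N′` (`N′ = Σ_{p ≥ 1} E_{p,p+1}`), with `a₀ = φ(1 − λ)⁻¹`-type and
`a₁ = φ(λ)`-type coefficients.  The iterated bracket of two such elements is EXACTLY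
`(a₀ b₁ − a₁ b₀) b₁^{n−1} E₀,ₙ₊₁` — the leading coefficient is the value of `φ_A ∧ φ_B` on the
Bloch–Suslin symbol `(1 − λ) ∧ λ`.  -/

section towers

/-- `E_{ab} E_{cd} = 0` when `b ≠ c`. -/
theorem E_mul_E_of_ne {m : ℕ} (a b c d : Fin m) (h : b ≠ c) : E K a b * E K c d = 0 := by
  ext i j
  rw [Matrix.mul_apply]
  apply Finset.sum_eq_zero
  intro l _
  simp only [E_apply]
  split_ifs with h1 h2 <;>
    first | exact mul_zero _ | exact zero_mul _ | exact absurd (h1.2.symm.trans h2.1) h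

/-- `[E₀ₖ, b₀ E₀₁ + b₁ N′] = b₁ E₀,ₖ₊₁` for `k ≥ 1`. -/
theorem lie_E0_tower (b₀ b₁ : K) (i1 k k' : Fin (n + 2)) (h1 : (i1 : ℕ) = 1)
    (hk : 1 ≤ (k : ℕ)) (hk' : (k' : ℕ) = k + 1) :
    ⁅(E K 0 k : 𝕄), b₀ • (E K 0 i1 : 𝕄) + b₁ • Nsup K (fun _ => (1 : K))⁆ = b₁ • (E K 0 k' : 𝕄) := by
  have hk0 : k ≠ 0 := by
    intro h; rw [h, Fin.val_zero] at hk; omega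
  have h10 : i1 ≠ 0 := by
    intro h; rw [h, Fin.val_zero] at h1; omega
  rw [Ring.lie_def, mul_add, add_mul, mul_smul_comm, mul_smul_comm, smul_mul_assoc, smul_mul_assoc,
    E_mul_E_of_ne 0 k 0 i1 hk0, E_mul_E_of_ne 0 i1 0 k h10, E0_mul_Nsup _ k k' hk hk',
    Nsup_mul_E0, smul_zero, smul_zero, one_smul, zero_add, add_zero, sub_zero]

/-- `[a₀ E₀₁ + a₁ N′, b₀ E₀₁ + b₁ N′] = (a₀ b₁ − a₁ b₀) E₀₂`: the Bloch–Suslin coefficient. -/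
theorem lie_tower_tower (a₀ a₁ b₀ b₁ : K) (i1 i2 : Fin (n + 2)) (h1 : (i1 : ℕ) = 1)
    (h2 : (i2 : ℕ) = 2) :
    ⁅a₀ • (E K 0 i1 : 𝕄) + a₁ • Nsup K (fun _ => (1 : K)),
      b₀ • (E K 0 i1 : 𝕄) + b₁ • Nsup K (fun _ => (1 : K))⁆ = (a₀ * b₁ - a₁ * b₀) • (E K 0 i2 : 𝕄) := by
  have h10 : i1 ≠ 0 := by
    intro h; rw [h, Fin.val_zero] at h1; omega
  have hi1 : 1 ≤ (i1 : ℕ) := by omega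
  have hi2 : (i2 : ℕ) = i1 + 1 := by omega
  rw [Ring.lie_def]
  simp only [mul_add, add_mul, mul_smul_comm, smul_mul_assoc, E_mul_E_of_ne 0 i1 0 i1 h10,
    E0_mul_Nsup _ i1 i2 hi1 hi2, Nsup_mul_E0, smul_zero, one_smul, zero_add, add_zero, smul_add,
    smul_smul, sub_smul, mul_comm b₁ a₁, mul_comm b₁ a₀]
  abel

/-- Iterated brackets of two exact degree-one tower elements:
`iterBr A B (j+1) = (a₀ b₁ − a₁ b₀) b₁^j • E₀,ⱼ₊₂`. -/
theorem iterBr_tower (a₀ a₁ b₀ b₁ : K) (i1 : Fin (n + 2)) (h1 : (i1 : ℕ) = 1) (j : ℕ)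
    (hj : j + 2 < n + 2) :
    iterBr (a₀ • (E K 0 i1 : 𝕄) + a₁ • Nsup K (fun _ => (1 : K)))
        (b₀ • (E K 0 i1 : 𝕄) + b₁ • Nsup K (fun _ => (1 : K))) (j + 1)
      = ((a₀ * b₁ - a₁ * b₀) * b₁ ^ j) • (E K 0 (⟨j + 2, hj⟩ : Fin (n + 2)) : 𝕄) := by
  induction j with
  | zero =>
    rw [iterBr_succ, iterBr_zero, pow_zero, mul_one]
    exact lie_tower_tower a₀ a₁ b₀ b₁ i1 _ h1 rfl
  | succ j ih =>
    rw [iterBr_succ, ih (by omega), Ring.lie_def, smul_mul_assoc, mul_smul_comm, ← smul_sub,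
      ← Ring.lie_def, lie_E0_tower b₀ b₁ i1 _ (⟨j + 3, by omega⟩ : Fin (n + 2)) h1 (by simp) rfl,
      smul_smul, pow_succ, mul_assoc]

/-- The corner: after `n` brackets (rank `n + 2`, `n ≥ 1`),
`iterBr A B n = (a₀ b₁ − a₁ b₀) b₁^{n−1} • E₀,ₙ₊₁`.  Non-zero iff the Bloch–Suslin coefficient
`a₀ b₁ − a₁ b₀` and `b₁` are non-zero. -/
theorem iterBr_tower_corner (hn : 1 ≤ n) (a₀ a₁ b₀ b₁ : K) (i1 : Fin (n + 2)) (h1 : (i1 : ℕ) = 1) :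
    iterBr (a₀ • (E K 0 i1 : 𝕄) + a₁ • Nsup K (fun _ => (1 : K)))
        (b₀ • (E K 0 i1 : 𝕄) + b₁ • Nsup K (fun _ => (1 : K))) n
      = ((a₀ * b₁ - a₁ * b₀) * b₁ ^ (n - 1)) • (E K 0 (Fin.last (n + 1)) : 𝕄) := by
  obtain ⟨m, rfl⟩ : ∃ m, n = m + 1 := ⟨n - 1, by omega⟩
  rw [iterBr_tower a₀ a₁ b₀ b₁ i1 h1 m (by omega), Nat.add_sub_cancel]
  rfl

/-- On a summand where the two elements coincide (e.g. the `λ = 1/2` tower, where every degree-one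
element is a multiple of `E₀₁ − N′`), all iterated brackets vanish. -/
theorem iterBr_self_succ (A : 𝕄) (k : ℕ) : iterBr A A (k + 1) = 0 := by
  induction k with
  | zero => rw [iterBr_succ, iterBr_zero, Ring.lie_def, sub_self]
  | succ k ih => rw [iterBr_succ, ih, Ring.lie_def, zero_mul, mul_zero, sub_self]

end towers

end PolylogBlocks

end SoloBlind

end Summit.KontsevichZagierPeriods.KontsevichZagierPeriods.Theorems
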